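import Literature.MathematicalPhysics.QuantumFieldTheory.MullerSchiemann1987.MS87Theorem3CommonSubsequence
import Literature.MathematicalPhysics.QuantumFieldTheory.MullerSchiemann1987.MS87Theorem3Continuation
import Literature.MathematicalPhysics.QuantumFieldTheory.MullerSchiemann1987.MS87MigdalStripWidening
import HarnessLib

/-!
# Müller–Schiemann, *Continuum limit of a hierarchical SU(2) lattice gauge theory in 4 dimensions*
# (CMP 110, 1987), THEOREM 3 (p.282) ON `SU(2)`, SECOND HALF: «These limit functions h^{(−n)}(z) uniquely define
# class functions g^{(−n)}(u), u ∈ G, and extensions g̃^{(−n)}(u, z), (2.7), satisfying (A₁)» and the LAST PARAGRAPH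
# of the proof (p.283 L.40–45): the extensions are ENTIRE in `z` — the limits of `MS87Theorem3CommonSubsequence`
# joined to (6.20)–(6.21) of `MS87Theorem3Continuation` and to the strip widening of `MS87MigdalStripWidening`,
# glued along the tower of scales (theorems only; no definition, no named fact)

statement-level skeleton of published theorems with citation tags; proofs where landed; nothing here is a claim about the Yang–Mills mass gap

**Citation header (reproduction of PUBLISHED work).** V. F. Müller, J. Schiemann, *Continuum limit of a hierarchical
SU(2) lattice gauge theory in 4 dimensions*, Commun. Math. Phys. **110** (1987) 261–286, doi 10.1007/BF01207367
[MullerSchiemann1987]; Theorem 3 p.282 and its proof p.282 L.29 – p.283 L.45, (6.19)–(6.22), (2.4)–(2.12) pp.263–264,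
(2.16)–(2.17) p.265, (3.1) p.266, (A₁) p.266 (held Project Euclid scan `paper:url-96df5da18d4c`; displays read by
this seat on its own 3× page renders `run/shared/lean/pub/lit-balaban/lit-balaban-p12/renders-cmp110ms/ms87-cmp110-
pdfp003,004,005,006,022,023-journalp263–266,282,283-x3.png`). Lean lane of the lit-balaban YM LIT SWEEP CONTEXT row
X1 (register level; zero weight for any token of that table); the model is the `d = 4` HIERARCHICAL `SU(2)` gauge model,
NOT lattice Yang–Mills.

**What the paper prints (Theorem 3 p.282 and the end of its proof p.283).** *«… These limit functions h^{(−n)}(z)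
uniquely define class functions g^{(−n)}(u), u ∈ G, and extensions g̃^{(−n)}(u, z), (2.7), satisfying (A₁). The sequence
g^{(−n)}(u), n ∈ ℕ₀, defines continuum effective actions at all scales due to the property 𝒯g^{(−n)}(u) = g^{(−n+1)}(u),
n ∈ ℕ …»*; p.283 L.1–6: *«Thus we can define, for u ∈ G and z ∈ ℂ, |Im z| < d_n, … g̃^{(−n)}(u, z) =
H^{(−n)}(u₀ cos z + u₃ sin z), (6.21) which is clearly continuous in u ∈ G and holomorphic in z, satisfying
(2.8)–(2.10). Equation (6.21) is the unique "analytic continuation," (2.7), of g^{(−n)}(u) := g̃^{(−n)}(u, 0) =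
H^{(−n)}(u₀) …»*; p.283 L.40–45: *«Finally the analytically extended version of 𝒯, (3.1), (3.8), when applied to
g̃^{(−n−1)}(u, z) as given by (6.21), yields an analytic continuation of g̃^{(−n)}(u, z) to the wider strip z ∈ ℂ,
|Im z| < r·(κ/2)(β^{(−n−1)})^{−α}. Iterating this argument, with r^m(β^{(−n−m)})^{−α} → ∞ (m → ∞), shows that
g̃^{(−n)}(u, z) is entire in z ∈ ℂ for all n. □»*; (A₁) p.266: *«g̃(u, z) is continuous in u ∈ G for fixed z ∈ ℂ and
entire holomorphic in z for fixed u.»*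

**What this file proves (kernel-checked, 0 sorry, standard axioms; no definition, no named fact).** `𝒢`, `𝒯_r` are
the sibling `MS87MigdalRecursion`'s `Migdal.InG`, `Migdal.migdal r`; `u₀, u₃, e^{−ixσ₃}` are `HeatKernel.u0/u3/
diagPhase`; the ellipse `𝒟(d) = {(Re w)²/cosh²d + (Im w)²/sinh²d < 1}` and the strips `{|Im z| < d}` are written out.
* §1 the limit (6.19) is even and `2π`-periodic ON THE STRIP when the `h_N^{(−n)}` are (Theorem 2 part 1),
  (2.11)–(2.12)): `periodic_of_limit`, `even_of_limit`.
* §2 (private plumbing) the strip representative `z ↦ h(z)·𝟙_{|Im z|<d}` is globally even/periodic and holomorphic on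
  the strip — the input format of the sibling's `eq621`.
* §3 **(6.20)–(6.21) from strip data** (`extension_of_strip`): for `h` holomorphic, even and `2π`-periodic on
  `{|Im z| < d}` there is `H` holomorphic on `𝒟(d)` with `h = H ∘ cos` on the strip, and
  `g̃(u, z) := H(u₀ cos z + u₃ sin z)` is holomorphic in `z` on the strip, jointly continuous on `SU(2) × strip`,
  satisfies (2.8), (2.9), `g̃(e₀, z) = h(z)` ((2.10)) and `g̃(u, 0) = H(u₀)`; `H(u₀(u)) = h(arccos u₀(u))`
  (`H_u0_eq_h_arccos`, (2.16)–(2.17)).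
* §4 **THEOREM 3 ON `SU(2)` WITH THE EXTENSIONS** (`theorem3_SU2`): the sibling `theorem3` (common subsequence `N_j`,
  (6.19), (6.22), `g^{(−n)} ∈ 𝒢`, `𝒯_r g^{(−n−1)} = g^{(−n)}`) with `θ = arccos ∘ u₀`, plus evenness ⟹ at every scale
  an `H^{(−n)}` holomorphic on `𝒟(d_n)` with (6.20) on the strip, (6.21) holomorphic/jointly continuous/(2.8)–(2.10),
  and `g^{(−n)}(u) = H^{(−n)}(u₀(u))` («g^{(−n)}(u) := g̃^{(−n)}(u, 0) = H^{(−n)}(u₀)»).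
* §5 **the widening tower, abstract** (`entire_of_tower`): scale-indexed families `A n` holomorphic on strips `d_n`,
  transforms `T n` doubling the strip of holomorphy and depending only on `B(·, z/2)`, with `T n (A (n+1)) = A n` on
  the strip of `A n`; if `d_n ≤ 2d_{n+1}` and `2^m d_{n+m} → ∞` then each `A n (x, ·)` is the restriction of an
  ENTIRE function (continuations `Ψ m n = T n (Ψ m (n+1))` on `{|Im z| < 2^m d_{n+m}}`, glued by the identity theorem
  on strips, the tree's `eqOn_setOf_abs_im_lt_of_forall_ofReal`, and `MigdalStripWidening.differentiable_of_strips`).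
* §6 **the one-step widening on `SU(2)`** (`widening_step`, `r = 2`): with `g = H(u₀)`, `g′ = H′(u₀)` a symmetric class
  function, `𝒯₂ g′ = g`: the extension `H(u₀ cos z + u₃ sin z)` and the continued recursion (3.1)
  `{∫dv g̃_{H′}(uv⁻¹, z/2) g̃_{H′}(v, z/2)/M}²`, `M = ∫g′²`, AGREE on `{|Im z| < min(d, 2d′)}` — both holomorphic
  (siblings `differentiableOn_eq621`, `differentiableOn_eq31`), equal for real `z = x` by (2.6)/(2.16)
  (`eq621_real_slice`: `g̃_H(u, x) = g(e^{−ixσ₃}u)`) and (2.4) (`Migdal.eq24_real`); hence the continuation to the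
  wider strip `{|Im z| < 2d′}` (`widening_step_exists`).
* §7 **«… g̃^{(−n)}(u, z) is entire in z ∈ ℂ for all n. □»** (`entire_of_limits`: §5 instantiated by §6 on `SU(2)`;
  `isSymm_of_eq_H_u0`: (2.3) for `g = H(u₀)`), and the assembled **`theorem3_SU2_entire`** (`r = 2`): the conclusions of
  `theorem3_SU2` AND, for every `n`, `u`, an ENTIRE `F` with `F = g̃^{(−n)}(u, ·)` on `{|Im z| < d_n}`.

**Readings / scope (declared).** (i) As in the sibling `theorem3`, the common subsequence comes from the Cantor
diagonal and property (i); injectivity (ii) of `𝒯` is neither used nor claimed. (ii) The continued recursion is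
written for `r = 2` ((3.1)); the gauge model's `r = 4` ((3.8), arguments `z/4`) is the same argument, not repeated
(the sibling `MS87MigdalStripWidening` made the same choice). (iii) The growth hypotheses `d_n ≤ 2d_{n+1}` and
`2^m d_{n+m} → ∞` render «the wider strip» and «r^m(β^{(−n−m)})^{−α} → ∞»; in the paper `d_n = (κ/2)(β^{(−n)})^{−α}`
with `β^{(−n)} = B_n + 𝒪(1)` (6.17), so both hold there; they are hypotheses here. (iv) «Entire» is rendered as: the
strip-defined extension is the restriction of an entire function (the extension beyond the strip is the glued tower,
unique by the identity theorem). (v) Uniqueness of (6.21) is the sibling's `eq621_unique` and is not re-proved.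

**Not claimed.** Property (ii); Theorems 1, 2, 4; the case `r = 4` written out; anything about lattice Yang–Mills or
the Clay problem.
-/

noncomputable section

open Filter Set Metric Function Complex
open scoped Topology Real

namespace Literature.MathematicalPhysics.QuantumFieldTheory

namespace MullerSchiemann1987

namespace Theorem3Extensions

open Literature.Analysis.Complex (isOpen_setOf_abs_im_lt)
open HeatKernel (u0 u3 diagPhase abs_u0_le_one u0_one u3_one u0_inv)
open Migdal (InG migdal IsCentral IsSymm eq24_real)
open MigdalStripWidening (abs_im_half_lt differentiableOn_eq31 continuousOn_eq31 differentiable_of_strips)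
open Theorem3CommonSubsequence (theorem3 abs_arccos_u0_le_pi cos_arccos_u0)
open Theorem3Continuation (eq621 eq621_unique eq621_symm28 eq621_symm29 eq621_at_zero eq621_at_one
  differentiableOn_eq621 continuousOn_eq621 differentiableOn_factor)

/-! ## §1 The limit (6.19) inherits evenness and `2π`-periodicity on the strip (Theorem 2 part 1), (2.11)–(2.12)) -/

/-- A locally uniform limit on the strip of (eventually) `2π`-periodic functions is `2π`-periodic on the strip.
[cite: MullerSchiemann1987, Thm 3 proof p.282 L.31–32 («Part 1) of Theorem 2 implies that h^{(−n)} is even,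
2π-periodic …»), (2.11) p.264] -/
theorem periodic_of_limit {d : ℝ} {F : ℕ → ℂ → ℂ} {f : ℂ → ℂ}
    (hF : TendstoLocallyUniformlyOn F f atTop {z : ℂ | |z.im| < d})
    (hper : ∀ᶠ j in atTop, Function.Periodic (F j) (2 * π)) {z : ℂ} (hz : |z.im| < d) :
    f (z + 2 * π) = f z := by
  have hz' : |(z + 2 * π).im| < d := by simpa using hz
  exact tendsto_nhds_unique ((hF.tendsto_at hz').congr' (hper.mono fun j hj => hj z)) (hF.tendsto_at hz)

/-- A locally uniform limit on the strip of (eventually) even functions is even on the strip.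
[cite: MullerSchiemann1987, Thm 3 proof p.282 L.31–32, (2.12) p.264] -/
theorem even_of_limit {d : ℝ} {F : ℕ → ℂ → ℂ} {f : ℂ → ℂ}
    (hF : TendstoLocallyUniformlyOn F f atTop {z : ℂ | |z.im| < d})
    (heven : ∀ᶠ j in atTop, ∀ z, F j (-z) = F j z) {z : ℂ} (hz : |z.im| < d) : f (-z) = f z := by
  have hz' : |(-z).im| < d := by simpa using hz
  exact tendsto_nhds_unique ((hF.tendsto_at hz').congr' (heven.mono fun j hj => hj z)) (hF.tendsto_at hz)

/-! ## §2 The strip representative `h♯(z) := h(z)` for `|Im z| < d`, `:= 0` otherwise: globally even and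
`2π`-periodic, equal to `h` on the strip and holomorphic there (the form in which the sibling's (6.20)/(6.21) `eq621`
takes its input; private plumbing) -/

/-- The strip representative `z ↦ if |Im z| < d then f z else 0` agrees with `f` on the strip. [folklore] -/
private theorem sharp_of_mem {d : ℝ} {f : ℂ → ℂ} {z : ℂ} (hz : |z.im| < d) :
    (fun w : ℂ => if |w.im| < d then f w else 0) z = f z := by
  simp [hz]

/-- The strip representative is holomorphic on the strip. [folklore] -/
private theorem differentiableOn_sharp {d : ℝ} {f : ℂ → ℂ} (hf : DifferentiableOn ℂ f {z : ℂ | |z.im| < d}) :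
    DifferentiableOn ℂ (fun w : ℂ => if |w.im| < d then f w else 0) {z : ℂ | |z.im| < d} :=
  hf.congr fun _ hz => sharp_of_mem hz

/-- The strip representative of a function even on the strip is even. [folklore] -/
private theorem sharp_even {d : ℝ} {f : ℂ → ℂ} (he : ∀ z : ℂ, |z.im| < d → f (-z) = f z) (z : ℂ) :
    (fun w : ℂ => if |w.im| < d then f w else 0) (-z) = (fun w : ℂ => if |w.im| < d then f w else 0) z := by
  by_cases hz : |z.im| < d
  · have hz' : |(-z).im| < d := by simpa using hz
    rw [sharp_of_mem hz', sharp_of_mem hz, he z hz]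
  · simp [hz]

/-- The strip representative of a function `2π`-periodic on the strip is `2π`-periodic. [folklore] -/
private theorem sharp_periodic {d : ℝ} {f : ℂ → ℂ} (hp : ∀ z : ℂ, |z.im| < d → f (z + 2 * π) = f z) :
    Function.Periodic (fun w : ℂ => if |w.im| < d then f w else 0) (2 * (Real.pi : ℂ)) := by
  intro z
  by_cases hz : |z.im| < d
  · have hz' : |(z + 2 * π).im| < d := by simpa using hz
    rw [sharp_of_mem hz', sharp_of_mem hz, hp z hz]
  · simp [hz]

/-! ## §3 (6.20)–(6.21) for a limit function: `h = H ∘ cos` on the strip with `H` holomorphic on the ellipse `𝒟(d)`,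
`g̃(u, z) = H(u₀ cos z + u₃ sin z)` holomorphic in `z` on the strip, jointly continuous, with (2.8)–(2.10) and
`g̃(u, 0) = H(u₀) = g(u)` when `g = Re h ∘ (arccos ∘ u₀)` -/

/-- **(6.20)–(6.21) from strip data only**: if `h` is holomorphic on `{|Im z| < d}` (`d > 0`) and even and
`2π`-periodic THERE, then there is `H` holomorphic on the ellipse `𝒟(d)` with `h(z) = H(cos z)` on the strip, and
`g̃(u, z) := H(u₀ cos z + u₃ sin z)` is holomorphic in `z` on the strip for every `u ∈ SU(2)`, jointly continuous on
`SU(2) × {|Im z| < d}`, satisfies (2.8) and (2.9), and `g̃(e₀, z) = h(z)` on the strip, `g̃(u, 0) = H(u₀)`.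
[cite: MullerSchiemann1987, (6.20)–(6.21) pp.282–283, (2.8)–(2.10) p.264] -/
theorem extension_of_strip {d : ℝ} (hd : 0 < d) {h : ℂ → ℂ} (hh : DifferentiableOn ℂ h {z : ℂ | |z.im| < d})
    (he : ∀ z : ℂ, |z.im| < d → h (-z) = h z) (hp : ∀ z : ℂ, |z.im| < d → h (z + 2 * π) = h z) :
    ∃ H : ℂ → ℂ, DifferentiableOn ℂ H {w : ℂ | w.re ^ 2 / Real.cosh d ^ 2 + w.im ^ 2 / Real.sinh d ^ 2 < 1} ∧
      (∀ z : ℂ, |z.im| < d → h z = H (Complex.cos z)) ∧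
      (∀ U : (Matrix.specialUnitaryGroup (Fin 2) ℂ), DifferentiableOn ℂ (fun z : ℂ => H ((u0 U : ℂ) * Complex.cos z + (u3 U : ℂ) * Complex.sin z))
          {z : ℂ | |z.im| < d}) ∧
      ContinuousOn (fun p : (Matrix.specialUnitaryGroup (Fin 2) ℂ) × ℂ => H ((u0 p.1 : ℂ) * Complex.cos p.2 + (u3 p.1 : ℂ) * Complex.sin p.2))
          {p | |p.2.im| < d} ∧
      (∀ (x : ℝ) (U : (Matrix.specialUnitaryGroup (Fin 2) ℂ)) (z : ℂ),
          H ((u0 (diagPhase x * U) : ℂ) * Complex.cos z + (u3 (diagPhase x * U) : ℂ) * Complex.sin z) =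
            H ((u0 U : ℂ) * Complex.cos ((x : ℂ) + z) + (u3 U : ℂ) * Complex.sin ((x : ℂ) + z))) ∧
      (∀ (U : (Matrix.specialUnitaryGroup (Fin 2) ℂ)) (z : ℂ), H ((u0 U⁻¹ : ℂ) * Complex.cos (-z) + (u3 U⁻¹ : ℂ) * Complex.sin (-z)) =
          H ((u0 U : ℂ) * Complex.cos z + (u3 U : ℂ) * Complex.sin z)) ∧
      (∀ z : ℂ, |z.im| < d →
          H ((u0 (1 : (Matrix.specialUnitaryGroup (Fin 2) ℂ)) : ℂ) * Complex.cos z + (u3 (1 : (Matrix.specialUnitaryGroup (Fin 2) ℂ)) : ℂ) * Complex.sin z) = h z) ∧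
      ∀ U : (Matrix.specialUnitaryGroup (Fin 2) ℂ), H ((u0 U : ℂ) * Complex.cos 0 + (u3 U : ℂ) * Complex.sin 0) = H (u0 U) := by
  obtain ⟨H, hH, hfac, hdiff, hone⟩ :=
    eq621 hd (differentiableOn_sharp hh) (sharp_even he) (sharp_periodic hp)
  refine ⟨H, hH, fun z hz => ?_, hdiff, continuousOn_eq621 hH.continuousOn, fun x U z => eq621_symm28 H x U z,
    fun U z => eq621_symm29 H U z, fun z hz => ?_, fun U => eq621_at_zero H U⟩
  · rw [← hfac z, if_pos hz]
  · rw [hone z, if_pos hz]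

/-- On the reals, `H(u₀(u)) = h(arccos u₀(u))`: the Gibbs factor `g(u) = H(u₀)` of (6.21) at `z = 0` is the angular
limit evaluated at the central angle. [cite: MullerSchiemann1987, (6.21) p.283, (2.16)–(2.17) p.265] -/
theorem H_u0_eq_h_arccos {d : ℝ} (hd : 0 < d) {h H : ℂ → ℂ} (hfac : ∀ z : ℂ, |z.im| < d → h z = H (Complex.cos z))
    (U : (Matrix.specialUnitaryGroup (Fin 2) ℂ)) : H (u0 U) = h (Real.arccos (u0 U)) := by
  have hz : |((Real.arccos (u0 U) : ℝ) : ℂ).im| < d := by rw [Complex.ofReal_im, abs_zero]; exact hd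
  rw [hfac _ hz, ← Complex.ofReal_cos, cos_arccos_u0]

/-! ## §4 THEOREM 3 for `G = SU(2)` with the extensions (6.21): common subsequence, limits at every scale,
`h^{(−n)} = H^{(−n)} ∘ cos`, `g̃^{(−n)}(u, z) = H^{(−n)}(u₀ cos z + u₃ sin z)`, `g̃^{(−n)}(u, 0) = g^{(−n)}(u)`,
`𝒯 g^{(−n−1)} = g^{(−n)}` -/

/-- **THEOREM 3 on `SU(2)` with the extensions (6.20)–(6.21).** Hypotheses as in the sibling `theorem3` with the
central angle `θ = arccos ∘ u₀` ((2.16)–(2.17)), plus EVENNESS of the `h_N^{(−n)}` ((2.12); Theorem 2 part 1)).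
Conclusion: one strictly increasing `N_j` and, for every scale `n`, limits `h^{(−n)}` (holomorphic on the strip
`{|Im z| < d_n}`, (6.19) locally uniformly), `g^{(−n)} ∈ 𝒢` ((6.22) uniformly on `SU(2)`, `𝒯_r g^{(−n−1)} = g^{(−n)}`),
and `H^{(−n)}` holomorphic on the ellipse `𝒟(d_n)` with **(6.20)** `h^{(−n)} = H^{(−n)} ∘ cos` on the strip and
**(6.21)**: `g̃^{(−n)}(u, z) := H^{(−n)}(u₀ cos z + u₃ sin z)` is holomorphic in `z` on the strip for every `u`,
jointly continuous, satisfies (2.8)–(2.9), `g̃^{(−n)}(e₀, z) = h^{(−n)}(z)` on the strip ((2.10)) and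
`g̃^{(−n)}(u, 0) = g^{(−n)}(u)` — «these limit functions h^{(−n)}(z) uniquely define class functions g^{(−n)}(u), u ∈ G,
and extensions g̃^{(−n)}(u, z), (2.7)» (uniqueness: the sibling `eq621_unique`). [cite: MullerSchiemann1987, Thm 3
p.282, (6.19)–(6.22) pp.282–283] -/
theorem theorem3_SU2 (r : ℕ) {d M : ℕ → ℝ} (hd : ∀ n, 0 < d n) {h : ℕ → ℕ → ℂ → ℂ} {g : ℕ → ℕ → (Matrix.specialUnitaryGroup (Fin 2) ℂ) → ℝ}
    (hhol : ∀ N n, n ≤ N → DifferentiableOn ℂ (h N n) {z : ℂ | |z.im| < d n})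
    (hbd : ∀ N n, n ≤ N → ∀ z : ℂ, |z.im| < d n → ‖h N n z‖ ≤ M n)
    (hper : ∀ N n, n ≤ N → Function.Periodic (h N n) (2 * π))
    (heven : ∀ N n, n ≤ N → ∀ z, h N n (-z) = h N n z)
    (hgh : ∀ N n, n ≤ N → ∀ U, (g N n U : ℂ) = h N n (Real.arccos (u0 U)))
    (hG : ∀ N n, n ≤ N → InG (g N n))
    (hrec : ∀ N n, n + 1 ≤ N → migdal r (g N (n + 1)) = g N n) :
    ∃ Nj : ℕ → ℕ, StrictMono Nj ∧ ∃ hlim : ℕ → ℂ → ℂ, ∃ glim : ℕ → (Matrix.specialUnitaryGroup (Fin 2) ℂ) → ℝ, ∃ Hlim : ℕ → ℂ → ℂ, ∀ n,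
      DifferentiableOn ℂ (hlim n) {z : ℂ | |z.im| < d n} ∧
      TendstoLocallyUniformlyOn (fun j => h (Nj j) n) (hlim n) atTop {z : ℂ | |z.im| < d n} ∧
      TendstoUniformly (fun j => g (Nj j) n) (glim n) atTop ∧
      InG (glim n) ∧ migdal r (glim (n + 1)) = glim n ∧
      DifferentiableOn ℂ (Hlim n) {w : ℂ | w.re ^ 2 / Real.cosh (d n) ^ 2 + w.im ^ 2 / Real.sinh (d n) ^ 2 < 1} ∧
      (∀ z : ℂ, |z.im| < d n → hlim n z = Hlim n (Complex.cos z)) ∧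
      (∀ U : (Matrix.specialUnitaryGroup (Fin 2) ℂ), DifferentiableOn ℂ
          (fun z : ℂ => Hlim n ((u0 U : ℂ) * Complex.cos z + (u3 U : ℂ) * Complex.sin z)) {z : ℂ | |z.im| < d n}) ∧
      ContinuousOn (fun p : (Matrix.specialUnitaryGroup (Fin 2) ℂ) × ℂ => Hlim n ((u0 p.1 : ℂ) * Complex.cos p.2 + (u3 p.1 : ℂ) * Complex.sin p.2))
          {p | |p.2.im| < d n} ∧
      (∀ (x : ℝ) (U : (Matrix.specialUnitaryGroup (Fin 2) ℂ)) (z : ℂ),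
          Hlim n ((u0 (diagPhase x * U) : ℂ) * Complex.cos z + (u3 (diagPhase x * U) : ℂ) * Complex.sin z) =
            Hlim n ((u0 U : ℂ) * Complex.cos ((x : ℂ) + z) + (u3 U : ℂ) * Complex.sin ((x : ℂ) + z))) ∧
      (∀ z : ℂ, |z.im| < d n →
          Hlim n ((u0 (1 : (Matrix.specialUnitaryGroup (Fin 2) ℂ)) : ℂ) * Complex.cos z + (u3 (1 : (Matrix.specialUnitaryGroup (Fin 2) ℂ)) : ℂ) * Complex.sin z) = hlim n z) ∧
      ∀ U : (Matrix.specialUnitaryGroup (Fin 2) ℂ), ((glim n U : ℝ) : ℂ) = Hlim n (u0 U) := by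
  obtain ⟨Nj, hNj, hlim, glim, hall⟩ :=
    theorem3 r (θ := fun U : (Matrix.specialUnitaryGroup (Fin 2) ℂ) => Real.arccos (u0 U)) (R := π) abs_arccos_u0_le_pi hd hhol hbd hper hgh hG hrec
  -- evenness and periodicity of the limits on the strips
  have hev : ∀ n, ∀ᶠ j in atTop, n ≤ Nj j := fun n =>
    Filter.eventually_atTop.mpr ⟨n, fun _ hj => le_trans hj hNj.le_apply⟩
  have hE : ∀ n, ∀ z : ℂ, |z.im| < d n → hlim n (-z) = hlim n z := fun n z hz =>
    even_of_limit (hall n).2.1 ((hev n).mono fun j hj => heven (Nj j) n hj) hz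
  have hP : ∀ n, ∀ z : ℂ, |z.im| < d n → hlim n (z + 2 * π) = hlim n z := fun n z hz =>
    periodic_of_limit (hall n).2.1 ((hev n).mono fun j hj => hper (Nj j) n hj) hz
  have hext : ∀ n, _ := fun n => extension_of_strip (hd n) (hall n).1 (hE n) (hP n)
  choose Hlim hH hfac hdiff hcont h28 h29 hone _hzero using hext
  refine ⟨Nj, hNj, hlim, glim, Hlim, fun n => ⟨(hall n).1, (hall n).2.1, (hall n).2.2.2.1, (hall n).2.2.2.2.1,
    (hall n).2.2.2.2.2.2, hH n, hfac n, hdiff n, hcont n, h28 n, hone n, fun U => ?_⟩⟩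
  rw [(hall n).2.2.2.2.2.1 U, H_u0_eq_h_arccos (hd n) (hfac n) U]


/-! ## §5 «Iterating this argument … shows that g̃^{(−n)}(u, z) is entire» (p.283 L.40–45): the abstract tower

An abstract rendering of the last paragraph of the proof of Theorem 3: scale-indexed families `A n : X → ℂ → ℂ`
holomorphic (and jointly continuous) on strips of half-width `d_n`, scale-indexed transforms `T n` that DOUBLE the strip
of holomorphy ((3.1) with `r = 2`: `T n B (x, z)` only involves `B(·, z/2)`), and the one-step identity
`T n (A (n+1)) = A n` on the strip of `A n` (the continued recursion reproduces the coarser scale). Then every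
`A n (x, ·)` is the restriction of an ENTIRE function, provided `2^m d_{n+m} → ∞` («with r^m (β^{(−n−m)})^{−α} → ∞»)
and `d_n ≤ 2 d_{n+1}`. -/

section Tower

variable {X : Type*} [TopologicalSpace X]

/-- **The widening tower** (abstract form of p.283 L.40–45): see the section docstring. The `m`-th continuation of
`A n` is `Ψ m n := T n (T (n+1) (⋯ (A (n+m))))`, holomorphic on `{|Im z| < 2^m d_{n+m}}` and equal to `A n` on
`{|Im z| < d_n}`; the continuations are glued along the exhausting strips by the identity theorem.
[cite: MullerSchiemann1987, Thm 3 proof p.283 L.40–45] -/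
theorem entire_of_tower (A : ℕ → X → ℂ → ℂ) (T : ℕ → (X → ℂ → ℂ) → X → ℂ → ℂ) (d : ℕ → ℝ)
    (hd : ∀ n, 0 < d n) (hd2 : ∀ n, d n ≤ 2 * d (n + 1))
    (hdiv : ∀ n, Tendsto (fun m : ℕ => (2 : ℝ) ^ m * d (n + m)) atTop atTop)
    (P1 : ∀ (n : ℕ) (e : ℝ) (B : X → ℂ → ℂ), ContinuousOn (uncurry B) (univ ×ˢ {z : ℂ | |z.im| < e}) →
      (∀ x, DifferentiableOn ℂ (B x) {z : ℂ | |z.im| < e}) →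
      ContinuousOn (uncurry (T n B)) (univ ×ˢ {z : ℂ | |z.im| < 2 * e}) ∧
        ∀ x, DifferentiableOn ℂ (T n B x) {z : ℂ | |z.im| < 2 * e})
    (P2 : ∀ (n : ℕ) (e : ℝ) (B B' : X → ℂ → ℂ), (∀ x, EqOn (B x) (B' x) {z : ℂ | |z.im| < e}) →
      ∀ x, EqOn (T n B x) (T n B' x) {z : ℂ | |z.im| < 2 * e})
    (P3 : ∀ n x, EqOn (T n (A (n + 1)) x) (A n x) {z : ℂ | |z.im| < d n})
    (P4 : ∀ n, ContinuousOn (uncurry (A n)) (univ ×ˢ {z : ℂ | |z.im| < d n}) ∧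
      ∀ x, DifferentiableOn ℂ (A n x) {z : ℂ | |z.im| < d n})
    (n : ℕ) (x : X) : ∃ F : ℂ → ℂ, Differentiable ℂ F ∧ EqOn F (A n x) {z : ℂ | |z.im| < d n} := by
  classical
  -- the continuations `Ψ m n = T n (Ψ m (n+1))`, `Ψ 0 = A`
  let Ψ : ℕ → ℕ → X → ℂ → ℂ := fun m =>
    Nat.rec (motive := fun _ => ℕ → X → ℂ → ℂ) A (fun _ Ψm k => T k (Ψm (k + 1))) m
  have Ψ_zero : Ψ 0 = A := rfl
  have Ψ_succ : ∀ m k, Ψ (m + 1) k = T k (Ψ m (k + 1)) := fun m k => rfl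
  -- the strip half-widths `c m k = 2^m d_{k+m}`
  let c : ℕ → ℕ → ℝ := fun m k => (2 : ℝ) ^ m * d (k + m)
  have c_zero : ∀ k, c 0 k = d k := fun k => by simp [c]
  have c_succ : ∀ m k, c (m + 1) k = 2 * c m (k + 1) := fun m k => by
    simp only [c]; rw [pow_succ, show k + (m + 1) = k + 1 + m by omega]; ring
  -- (1) holomorphy and joint continuity of the continuations
  have h1 : ∀ m k, ContinuousOn (uncurry (Ψ m k)) (univ ×ˢ {z : ℂ | |z.im| < c m k}) ∧
      ∀ y, DifferentiableOn ℂ (Ψ m k y) {z : ℂ | |z.im| < c m k} := by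
    intro m
    induction m with
    | zero => intro k; rw [Ψ_zero, c_zero]; exact P4 k
    | succ m ih =>
        intro k
        rw [Ψ_succ, c_succ]
        exact P1 k (c m (k + 1)) (Ψ m (k + 1)) (ih (k + 1)).1 (ih (k + 1)).2
  -- (2) the continuations agree with `A k` on the original strip
  have h2 : ∀ m k y, EqOn (Ψ m k y) (A k y) {z : ℂ | |z.im| < d k} := by
    intro m
    induction m with
    | zero => intro k y z _; rw [Ψ_zero]
    | succ m ih =>
        intro k y
        rw [Ψ_succ]
        have hsub : {z : ℂ | |z.im| < d k} ⊆ {z : ℂ | |z.im| < 2 * d (k + 1)} :=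
          fun z hz => lt_of_lt_of_le hz (hd2 k)
        exact ((P2 k (d (k + 1)) (Ψ m (k + 1)) (A (k + 1)) (ih (k + 1)) y).mono hsub).trans (P3 k y)
  -- (3) the strips exhaust: `d n ≤ c m n`
  have h3 : ∀ m k, d k ≤ c m k := by
    intro m
    induction m with
    | zero => intro k; rw [c_zero]
    | succ m ih => intro k; rw [c_succ]; linarith [ih (k + 1), hd2 k, hd (k + 1)]
  -- (4) two continuations agree on the smaller of their strips (identity theorem from the real axis)
  have h4 : ∀ m m', EqOn (Ψ m n x) (Ψ m' n x) {z : ℂ | |z.im| < min (c m n) (c m' n)} := by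
    intro m m'
    refine Literature.Analysis.Complex.eqOn_setOf_abs_im_lt_of_forall_ofReal
      (lt_min (lt_of_lt_of_le (hd n) (h3 m n)) (lt_of_lt_of_le (hd n) (h3 m' n)))
      (((h1 m n).2 x).mono fun z (hz : |z.im| < min (c m n) (c m' n)) =>
        show |z.im| < c m n from lt_of_lt_of_le hz (min_le_left _ _))
      (((h1 m' n).2 x).mono fun z (hz : |z.im| < min (c m n) (c m' n)) =>
        show |z.im| < c m' n from lt_of_lt_of_le hz (min_le_right _ _)) fun t => ?_
    have ht : ((t : ℂ)) ∈ {z : ℂ | |z.im| < d n} := by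
      show |(t : ℂ).im| < d n; rw [Complex.ofReal_im, abs_zero]; exact hd n
    rw [h2 m n x ht, h2 m' n x ht]
  -- (5) glue
  have hex : ∀ z : ℂ, ∃ m, |z.im| < c m n := fun z =>
    (((hdiv n).eventually (eventually_gt_atTop |z.im|))).exists
  choose mz hmz using hex
  refine ⟨fun z => Ψ (mz z) n x z, ?_, ?_⟩
  · refine differentiable_of_strips (c := fun m => c m n) (hdiv n) fun m => ?_
    refine ((h1 m n).2 x).congr fun z hz => ?_
    exact h4 (mz z) m (lt_min (hmz z) hz)
  · intro z hz
    have hz0 : |z.im| < c 0 n := by rw [c_zero]; exact hz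
    show Ψ (mz z) n x z = A n x z
    rw [h4 (mz z) 0 (lt_min (hmz z) hz0), Ψ_zero]

end Tower

/-! ## §6 The one-step widening on `SU(2)` (p.283 L.40–43 with (3.1), `r = 2`): the continued recursion applied to
`g̃^{(−n−1)}` reproduces `g̃^{(−n)}` on its strip — identity theorem from the REAL identity
`g̃^{(−n)}(u, x) = g^{(−n)}(e^{−ixσ₃}u) = 𝒯₂ g^{(−n−1)}(e^{−ixσ₃}u)` ((2.6), (2.4) = the sibling's `Migdal.eq24_real`) -/

/-- (2.6)/(2.16) for the extension (6.21): on the real axis `g̃_H(u, s) = g(e^{−isσ₃}u)` when `g = H(u₀)`, for real `s`.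
[cite: MullerSchiemann1987, (2.6) p.264, (2.16) p.265, (6.21) p.283] -/
theorem eq621_real_slice {H : ℂ → ℂ} {g : (Matrix.specialUnitaryGroup (Fin 2) ℂ) → ℝ} (hg : ∀ U, (g U : ℂ) = H (u0 U)) (W : (Matrix.specialUnitaryGroup (Fin 2) ℂ)) (s : ℝ) :
    H ((u0 W : ℂ) * Complex.cos (s : ℂ) + (u3 W : ℂ) * Complex.sin (s : ℂ)) = (g (diagPhase s * W) : ℂ) := by
  have h1 := eq621_symm28 H s W 0
  rw [add_zero, eq621_at_zero H (diagPhase s * W)] at h1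
  rw [← h1, hg]

/-- **One widening step** (`r = 2`): with `g = H(u₀)`, `g′ = H′(u₀)` central and symmetric, `𝒯₂ g′ = g`, the extension
`g̃_H(u, z) = H(u₀ cos z + u₃ sin z)` ((6.21) at scale `−n`) and the continued recursion (3.1) applied to `g̃_{H′}`
(scale `−n−1`), `z ↦ {∫dv g̃_{H′}(uv⁻¹, z/2) g̃_{H′}(v, z/2)/M}²`, `M = ∫ g′²` ((5.3)), AGREE on the strip
`{|Im z| < min(d, 2d′)}` — both are holomorphic there and they agree for real `z = x` by (2.4)/(2.6).
[cite: MullerSchiemann1987, Thm 3 proof p.283 L.40–43, (3.1) p.266, (2.4) p.263] -/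
theorem widening_step {d d' : ℝ} (hd : 0 < d) (hd' : 0 < d') {H H' : ℂ → ℂ} {g g' : (Matrix.specialUnitaryGroup (Fin 2) ℂ) → ℝ}
    (hH : DifferentiableOn ℂ H {w : ℂ | w.re ^ 2 / Real.cosh d ^ 2 + w.im ^ 2 / Real.sinh d ^ 2 < 1})
    (hH' : DifferentiableOn ℂ H' {w : ℂ | w.re ^ 2 / Real.cosh d' ^ 2 + w.im ^ 2 / Real.sinh d' ^ 2 < 1})
    (hg : ∀ U, (g U : ℂ) = H (u0 U)) (hg' : ∀ U, (g' U : ℂ) = H' (u0 U)) (hc' : IsCentral g') (hs' : IsSymm g')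
    (hT : migdal 2 g' = g) (U : (Matrix.specialUnitaryGroup (Fin 2) ℂ)) :
    EqOn (fun z : ℂ => H ((u0 U : ℂ) * Complex.cos z + (u3 U : ℂ) * Complex.sin z))
      (fun z : ℂ => ((∫ V, H' ((u0 (U * V⁻¹) : ℂ) * Complex.cos (z / 2) + (u3 (U * V⁻¹) : ℂ) * Complex.sin (z / 2)) *
          H' ((u0 V : ℂ) * Complex.cos (z / 2) + (u3 V : ℂ) * Complex.sin (z / 2))
          ∂(haarProbability (Matrix.specialUnitaryGroup (Fin 2) ℂ))) / ((∫ v, g' v ^ 2 ∂(haarProbability (Matrix.specialUnitaryGroup (Fin 2) ℂ)) : ℝ) : ℂ)) ^ 2)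
      {z : ℂ | |z.im| < min d (2 * d')} := by
  have hmin : 0 < min d (2 * d') := lt_min hd (by linarith)
  -- joint continuity of `g̃_{H′}` in the form the sibling's (3.1) lemmas take
  have hcont : ContinuousOn (uncurry fun (W : (Matrix.specialUnitaryGroup (Fin 2) ℂ)) (w : ℂ) =>
      H' ((u0 W : ℂ) * Complex.cos w + (u3 W : ℂ) * Complex.sin w)) (univ ×ˢ {z : ℂ | |z.im| < d'}) := by
    have := continuousOn_eq621 hH'.continuousOn
    rw [show (univ ×ˢ {z : ℂ | |z.im| < d'} : Set ((Matrix.specialUnitaryGroup (Fin 2) ℂ) × ℂ)) = {p | |p.2.im| < d'} by ext p; simp]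
    exact this
  refine Literature.Analysis.Complex.eqOn_setOf_abs_im_lt_of_forall_ofReal hmin
    ((differentiableOn_eq621 hH U).mono fun z (hz : |z.im| < min d (2 * d')) =>
      show |z.im| < d from lt_of_lt_of_le hz (min_le_left _ _))
    ((differentiableOn_eq31 hcont (fun W => differentiableOn_eq621 hH' W)
        ((∫ v, g' v ^ 2 ∂(haarProbability (Matrix.specialUnitaryGroup (Fin 2) ℂ)) : ℝ) : ℂ) U).mono
      fun z (hz : |z.im| < min d (2 * d')) => show |z.im| < 2 * d' from lt_of_lt_of_le hz (min_le_right _ _))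
    fun t => ?_
  -- the real identity: (2.6) on both levels and (2.4) = `eq24_real`
  show H ((u0 U : ℂ) * Complex.cos (t : ℂ) + (u3 U : ℂ) * Complex.sin (t : ℂ)) =
    ((∫ V, H' ((u0 (U * V⁻¹) : ℂ) * Complex.cos ((t : ℂ) / 2) + (u3 (U * V⁻¹) : ℂ) * Complex.sin ((t : ℂ) / 2)) *
        H' ((u0 V : ℂ) * Complex.cos ((t : ℂ) / 2) + (u3 V : ℂ) * Complex.sin ((t : ℂ) / 2))
        ∂(haarProbability (Matrix.specialUnitaryGroup (Fin 2) ℂ))) / ((∫ v, g' v ^ 2 ∂(haarProbability (Matrix.specialUnitaryGroup (Fin 2) ℂ)) : ℝ) : ℂ)) ^ 2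
  rw [eq621_real_slice hg U t, ← hT, eq24_real hc' hs' t U,
    show (t : ℂ) / 2 = ((t / 2 : ℝ) : ℂ) by push_cast; ring]
  have e : (fun V : (Matrix.specialUnitaryGroup (Fin 2) ℂ) => H' ((u0 (U * V⁻¹) : ℂ) * Complex.cos ((t / 2 : ℝ) : ℂ) +
        (u3 (U * V⁻¹) : ℂ) * Complex.sin ((t / 2 : ℝ) : ℂ)) *
      H' ((u0 V : ℂ) * Complex.cos ((t / 2 : ℝ) : ℂ) + (u3 V : ℂ) * Complex.sin ((t / 2 : ℝ) : ℂ))) =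
      fun V : (Matrix.specialUnitaryGroup (Fin 2) ℂ) => ((g' (diagPhase (t / 2) * U * V⁻¹) * g' (diagPhase (t / 2) * V) : ℝ) : ℂ) := by
    funext V
    rw [eq621_real_slice hg' (U * V⁻¹) (t / 2), eq621_real_slice hg' V (t / 2), ← mul_assoc]
    push_cast; ring
  rw [e, integral_complex_ofReal]
  push_cast
  ring

/-- Hence (when `d ≤ 2d′`, the paper's regime) `g̃^{(−n)}(u, ·)` CONTINUES analytically from `{|Im z| < d}` to the
wider strip `{|Im z| < 2d′}`. [cite: MullerSchiemann1987, Thm 3 proof p.283 L.40–43] -/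
theorem widening_step_exists {d d' : ℝ} (hd : 0 < d) (hd' : 0 < d') (hdd : d ≤ 2 * d') {H H' : ℂ → ℂ}
    {g g' : (Matrix.specialUnitaryGroup (Fin 2) ℂ) → ℝ}
    (hH : DifferentiableOn ℂ H {w : ℂ | w.re ^ 2 / Real.cosh d ^ 2 + w.im ^ 2 / Real.sinh d ^ 2 < 1})
    (hH' : DifferentiableOn ℂ H' {w : ℂ | w.re ^ 2 / Real.cosh d' ^ 2 + w.im ^ 2 / Real.sinh d' ^ 2 < 1})
    (hg : ∀ U, (g U : ℂ) = H (u0 U)) (hg' : ∀ U, (g' U : ℂ) = H' (u0 U)) (hc' : IsCentral g') (hs' : IsSymm g')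
    (hT : migdal 2 g' = g) (U : (Matrix.specialUnitaryGroup (Fin 2) ℂ)) :
    ∃ F : ℂ → ℂ, DifferentiableOn ℂ F {z : ℂ | |z.im| < 2 * d'} ∧
      EqOn F (fun z : ℂ => H ((u0 U : ℂ) * Complex.cos z + (u3 U : ℂ) * Complex.sin z)) {z : ℂ | |z.im| < d} := by
  have hcont : ContinuousOn (uncurry fun (W : (Matrix.specialUnitaryGroup (Fin 2) ℂ)) (w : ℂ) =>
      H' ((u0 W : ℂ) * Complex.cos w + (u3 W : ℂ) * Complex.sin w)) (univ ×ˢ {z : ℂ | |z.im| < d'}) := by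
    have := continuousOn_eq621 hH'.continuousOn
    rw [show (univ ×ˢ {z : ℂ | |z.im| < d'} : Set ((Matrix.specialUnitaryGroup (Fin 2) ℂ) × ℂ)) = {p | |p.2.im| < d'} by ext p; simp]
    exact this
  refine ⟨_, differentiableOn_eq31 hcont (fun W => differentiableOn_eq621 hH' W)
    ((∫ v, g' v ^ 2 ∂(haarProbability (Matrix.specialUnitaryGroup (Fin 2) ℂ)) : ℝ) : ℂ) U, fun z hz => ?_⟩
  have hz' : z ∈ {z : ℂ | |z.im| < min d (2 * d')} := by
    show |z.im| < min d (2 * d'); rw [min_eq_left hdd]; exact hz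
  exact ((widening_step hd hd' hH hH' hg hg' hc' hs' hT U) hz').symm


/-! ## §7 «… shows that g̃^{(−n)}(u, z) is entire in z ∈ ℂ for all n. □» — the tower on `SU(2)` and THEOREM 3 with
(A₁)'s entire-ness of the extensions -/

/-- The symmetry (2.3) of a Gibbs factor of the form `g = H(u₀)` (`u₀(u⁻¹) = u₀(u)`). [cite: MullerSchiemann1987,
(2.3) p.263, (6.21) p.283] -/
theorem isSymm_of_eq_H_u0 {H : ℂ → ℂ} {g : (Matrix.specialUnitaryGroup (Fin 2) ℂ) → ℝ} (hg : ∀ U, (g U : ℂ) = H (u0 U)) : IsSymm g := by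
  intro U
  apply Complex.ofReal_injective
  rw [hg, hg, u0_inv]

/-- **Entire-ness of the limit extensions** (p.283 L.40–45 on `SU(2)`, `r = 2`): if at every scale `n` the Gibbs
factor is `g^{(−n)} = H^{(−n)}(u₀)` with `H^{(−n)}` holomorphic on the ellipse `𝒟(d_n)`, `g^{(−n)}` a class function,
and `𝒯₂ g^{(−n−1)} = g^{(−n)}`, and if the strip half-widths satisfy `d_n ≤ 2d_{n+1}` and `2^m d_{n+m} → ∞`, then
for every `n` and `u` the extension `z ↦ g̃^{(−n)}(u, z) = H^{(−n)}(u₀ cos z + u₃ sin z)` is the restriction to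
`{|Im z| < d_n}` of an ENTIRE function. [cite: MullerSchiemann1987, Thm 3 proof p.283 L.40–45, (A₁) p.266] -/
theorem entire_of_limits (d : ℕ → ℝ) (hd : ∀ n, 0 < d n) (hd2 : ∀ n, d n ≤ 2 * d (n + 1))
    (hdiv : ∀ n, Tendsto (fun m : ℕ => (2 : ℝ) ^ m * d (n + m)) atTop atTop)
    {Hl : ℕ → ℂ → ℂ} {gl : ℕ → (Matrix.specialUnitaryGroup (Fin 2) ℂ) → ℝ}
    (hH : ∀ n, DifferentiableOn ℂ (Hl n)
      {w : ℂ | w.re ^ 2 / Real.cosh (d n) ^ 2 + w.im ^ 2 / Real.sinh (d n) ^ 2 < 1})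
    (hgH : ∀ n U, (gl n U : ℂ) = Hl n (u0 U)) (hc : ∀ n, IsCentral (gl n))
    (hT : ∀ n, migdal 2 (gl (n + 1)) = gl n) (n : ℕ) (U : (Matrix.specialUnitaryGroup (Fin 2) ℂ)) :
    ∃ F : ℂ → ℂ, Differentiable ℂ F ∧
      EqOn F (fun z : ℂ => Hl n ((u0 U : ℂ) * Complex.cos z + (u3 U : ℂ) * Complex.sin z))
        {z : ℂ | |z.im| < d n} := by
  -- `SU(2) ⊆ M₂(ℂ)` is first countable (needed for the dominated-convergence continuity of (3.1))
  haveI : FirstCountableTopology (Matrix (Fin 2) (Fin 2) ℂ) :=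
    inferInstanceAs (FirstCountableTopology (Fin 2 → Fin 2 → ℂ))
  haveI : FirstCountableTopology (Matrix.specialUnitaryGroup (Fin 2) ℂ) := Topology.IsInducing.subtypeVal.firstCountableTopology
  -- joint continuity of the extensions in the sibling's format
  have hcont : ∀ k, ContinuousOn (uncurry fun (W : (Matrix.specialUnitaryGroup (Fin 2) ℂ)) (w : ℂ) =>
      Hl k ((u0 W : ℂ) * Complex.cos w + (u3 W : ℂ) * Complex.sin w)) (univ ×ˢ {z : ℂ | |z.im| < d k}) := by
    intro k
    have := continuousOn_eq621 (hH k).continuousOn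
    rw [show (univ ×ˢ {z : ℂ | |z.im| < d k} : Set ((Matrix.specialUnitaryGroup (Fin 2) ℂ) × ℂ)) = {p | |p.2.im| < d k} by ext p; simp]
    exact this
  refine entire_of_tower
    (fun k (W : (Matrix.specialUnitaryGroup (Fin 2) ℂ)) (w : ℂ) => Hl k ((u0 W : ℂ) * Complex.cos w + (u3 W : ℂ) * Complex.sin w))
    (fun k (B : (Matrix.specialUnitaryGroup (Fin 2) ℂ) → ℂ → ℂ) (W : (Matrix.specialUnitaryGroup (Fin 2) ℂ)) (w : ℂ) =>
      ((∫ V, B (W * V⁻¹) (w / 2) * B V (w / 2) ∂(haarProbability (Matrix.specialUnitaryGroup (Fin 2) ℂ))) /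
        ((∫ v, gl (k + 1) v ^ 2 ∂(haarProbability (Matrix.specialUnitaryGroup (Fin 2) ℂ)) : ℝ) : ℂ)) ^ 2)
    d hd hd2 hdiv ?_ ?_ ?_ ?_ n U
  · intro k e B hBc hBh
    exact ⟨continuousOn_eq31 hBc _, fun W => differentiableOn_eq31 hBc hBh _ W⟩
  · intro k e B B' hBB' W w hw
    have hw' : |(w / 2).im| < e := abs_im_half_lt hw
    have hI : (fun V : (Matrix.specialUnitaryGroup (Fin 2) ℂ) => B (W * V⁻¹) (w / 2) * B V (w / 2)) =
        fun V : (Matrix.specialUnitaryGroup (Fin 2) ℂ) => B' (W * V⁻¹) (w / 2) * B' V (w / 2) := by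
      funext V
      rw [hBB' (W * V⁻¹) hw', hBB' V hw']
    show ((∫ V, B (W * V⁻¹) (w / 2) * B V (w / 2) ∂(haarProbability (Matrix.specialUnitaryGroup (Fin 2) ℂ))) /
        ((∫ v, gl (k + 1) v ^ 2 ∂(haarProbability (Matrix.specialUnitaryGroup (Fin 2) ℂ)) : ℝ) : ℂ)) ^ 2 =
      ((∫ V, B' (W * V⁻¹) (w / 2) * B' V (w / 2) ∂(haarProbability (Matrix.specialUnitaryGroup (Fin 2) ℂ))) /
        ((∫ v, gl (k + 1) v ^ 2 ∂(haarProbability (Matrix.specialUnitaryGroup (Fin 2) ℂ)) : ℝ) : ℂ)) ^ 2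
    rw [hI]
  · intro k W w hw
    have h := widening_step (hd k) (hd (k + 1)) (hH k) (hH (k + 1)) (hgH k) (hgH (k + 1)) (hc (k + 1))
      (isSymm_of_eq_H_u0 (hgH (k + 1))) (hT k) W
    have hw' : w ∈ {z : ℂ | |z.im| < min (d k) (2 * d (k + 1))} := by
      show |w.im| < min (d k) (2 * d (k + 1)); rw [min_eq_left (hd2 k)]; exact hw
    exact (h hw').symm
  · intro k
    exact ⟨hcont k, fun W => differentiableOn_eq621 (hH k) W⟩

/-- **THEOREM 3 on `SU(2)`, `r = 2`, with (A₁)'s «entire holomorphic in z»** for the limit extensions: under the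
hypotheses of `theorem3_SU2` and the growth of the strips (`d_n ≤ 2d_{n+1}`, `2^m d_{n+m} → ∞`: the paper's
«r^m (β^{(−n−m)})^{−α} → ∞»), the limit extensions `g̃^{(−n)}(u, ·)` are restrictions of ENTIRE functions, on top of
all conclusions of `theorem3_SU2`. This is the last paragraph of the proof of Theorem 3 applied to the limits it
constructs. [cite: MullerSchiemann1987, Thm 3 p.282 («satisfying (A₁)»), proof p.283 L.40–45] -/
theorem theorem3_SU2_entire {d M : ℕ → ℝ} (hd : ∀ n, 0 < d n) (hd2 : ∀ n, d n ≤ 2 * d (n + 1))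
    (hdiv : ∀ n, Tendsto (fun m : ℕ => (2 : ℝ) ^ m * d (n + m)) atTop atTop)
    {h : ℕ → ℕ → ℂ → ℂ} {g : ℕ → ℕ → (Matrix.specialUnitaryGroup (Fin 2) ℂ) → ℝ}
    (hhol : ∀ N n, n ≤ N → DifferentiableOn ℂ (h N n) {z : ℂ | |z.im| < d n})
    (hbd : ∀ N n, n ≤ N → ∀ z : ℂ, |z.im| < d n → ‖h N n z‖ ≤ M n)
    (hper : ∀ N n, n ≤ N → Function.Periodic (h N n) (2 * π))
    (heven : ∀ N n, n ≤ N → ∀ z, h N n (-z) = h N n z)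
    (hgh : ∀ N n, n ≤ N → ∀ U, (g N n U : ℂ) = h N n (Real.arccos (u0 U)))
    (hG : ∀ N n, n ≤ N → InG (g N n))
    (hrec : ∀ N n, n + 1 ≤ N → migdal 2 (g N (n + 1)) = g N n) :
    ∃ Nj : ℕ → ℕ, StrictMono Nj ∧ ∃ hlim : ℕ → ℂ → ℂ, ∃ glim : ℕ → (Matrix.specialUnitaryGroup (Fin 2) ℂ) → ℝ, ∃ Hlim : ℕ → ℂ → ℂ,
      (∀ n, DifferentiableOn ℂ (hlim n) {z : ℂ | |z.im| < d n} ∧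
        TendstoLocallyUniformlyOn (fun j => h (Nj j) n) (hlim n) atTop {z : ℂ | |z.im| < d n} ∧
        TendstoUniformly (fun j => g (Nj j) n) (glim n) atTop ∧
        InG (glim n) ∧ migdal 2 (glim (n + 1)) = glim n ∧
        DifferentiableOn ℂ (Hlim n)
          {w : ℂ | w.re ^ 2 / Real.cosh (d n) ^ 2 + w.im ^ 2 / Real.sinh (d n) ^ 2 < 1} ∧
        (∀ z : ℂ, |z.im| < d n → hlim n z = Hlim n (Complex.cos z)) ∧
        (∀ U : (Matrix.specialUnitaryGroup (Fin 2) ℂ), ((glim n U : ℝ) : ℂ) = Hlim n (u0 U))) ∧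
      ∀ n (U : (Matrix.specialUnitaryGroup (Fin 2) ℂ)), ∃ F : ℂ → ℂ, Differentiable ℂ F ∧
        EqOn F (fun z : ℂ => Hlim n ((u0 U : ℂ) * Complex.cos z + (u3 U : ℂ) * Complex.sin z))
          {z : ℂ | |z.im| < d n} := by
  obtain ⟨Nj, hNj, hlim, glim, Hlim, hall⟩ := theorem3_SU2 2 hd hhol hbd hper heven hgh hG hrec
  refine ⟨Nj, hNj, hlim, glim, Hlim, fun n => ⟨(hall n).1, (hall n).2.1, (hall n).2.2.1, (hall n).2.2.2.1,
    (hall n).2.2.2.2.1, (hall n).2.2.2.2.2.1, (hall n).2.2.2.2.2.2.1, (hall n).2.2.2.2.2.2.2.2.2.2.2⟩, ?_⟩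
  exact entire_of_limits d hd hd2 hdiv (fun n => (hall n).2.2.2.2.2.1) (fun n => (hall n).2.2.2.2.2.2.2.2.2.2.2)
    (fun n => (hall n).2.2.2.1.central) (fun n => (hall n).2.2.2.2.1)

end Theorem3Extensions

end MullerSchiemann1987

end Literature.MathematicalPhysics.QuantumFieldTheory
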